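/-
COR-CM (cell pub-hodgecm2, stage 2 of the Hodge ladder) — lane V-TRANSPORT (seat b06 gen 22; count-neutral, no BINDER-OWNERS row,
no E term, no display of record; Interfaces (C1) untouched).  The degree-6 count of IDEA-1g's orbit normal form (b01-idea-1 gen 7, memo §0
Δ5: «at [F:ℚ] = 6, ONE non-zero face period on ONE Picard modular surface over F gives PeriodThmF|_F on U_rec»), as a kernel theorem.
Wording of record (verbatim, unchanged by this file): HC_CM follows in the kernel from BallQuotientUniformised ∧ PerLFace(model universe of record).
T5: consistency check by b06 g22 2026-08-21T18:22Z — BY INHABITATION: the only named-fact hypothesis binders of the new theorems are the four universe-of-record records `exists_isReal_hodgeModel` / `hodgePQ_independent_of_hodgeModel` / `BallQuotientUniformised` (resp. `BallQuotientUniformisedDatum`) / `CMAbelianVarietyRealised`, all DISCHARGED tree theorems (`exists_isReal_hodgeModel_holds`, `hodgePQ_independent_of_hodgeModel_holds`, `BallQuotient.ballQuotientUniformised_holds` / `ballQuotientUniformisedDatum_of`, `cmAbelianVarietyRealised_holds`), so their conjunction is inhabited and no contradiction is derivable; the remaining binders are data and elementary side conditions (`2 < finrank ℚ L`, `IsGalois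 ℚ F`, `finrank ℚ F = 6`, a `PeriodNV`/`PerL` ANTECEDENT of the same open kind as the conclusion — transports, no supply hypothesis, no hand-summarised Literature binder) — no contradiction derived.  HC_CM is NOT proved.
-/
import Summits.HodgeConjecture.CorCM.FacePeriodOrbit
import Summits.HodgeConjecture.CorCM.CyclicSexticFaces
import Summits.HodgeConjecture.CorCM.Geometry.NonVacuity
import HarnessLib

/-!
# COR-CM — over a Galois sextic CM field, ONE non-zero face period gives them all (universe of record)

Let `F` be a Galois CM field with `[F:ℚ] = 6` (so `Gal(F/ℚ) = ⟨σ⟩ ≅ C₆`, `σ³ = ρ`: `CyclicSextic.exists_generator`).  In the coordinates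
`φ = p ∘ σⁿ` of `CyclicSexticCMTypes` (`emb`, `ind6`, `shiftB`, `flipB`), a rank-four face is an antipodal vector `χ ∈ Bool⁶` with two of
the three places marked; twisting by `σᵏ` shifts `χ` by `k` and the marked places by `-k`.  The finite check `twistSquareB` (by `decide`)
says: any face `f` has the SAME TYPE SQUARE (b07 `FaceSquareSymmetry`: same unordered pair of places, base type among the four corners) as
some Galois twist `f₀.twist (σᵏ)` of any other face `f₀` — rotate the unmarked place into position (`k mod 3`) and, if necessary, complement
(`k ↦ k + 3`).  Hence:

* `CyclicSextic.exists_twist_sameSquare` — for faces `f₀, f` of `F`: `∃ k, f ~_square f₀.twist (σᵏ)`;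
* **`Model.periodNV_of_periodNV_sextic`** — on `U = Model.picardCMUniverse hHD hI h₁ h₃`: ONE instance `U.PeriodNV ι₀ V₀ F f₀.psi ι₀`
  (`ι₀` admissible for `f₀`) implies `U.PeriodNV ι₁ V F f.psi ι₁` for EVERY face `f`, EVERY admissible `ι₁` and EVERY hermitian space `V`
  (orbit normal form `Model.periodNV_orbit` — rows A/B b06, C b07, T idea-1 — then b07's `Model.periodNV_iff_of_sameSquare`);
* **`Model.periodThmF_sextic_iff_exists`** — the degree-6 part of `PeriodThmF(U) = PerLFace(U)` is equivalent to: for every Galois sextic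
  CM field `F`, SOME face datum `(f₀, ι₀, V₀)` has a non-zero period.

This changes no row and creates no period: per field, that one instance is exactly the content of the open leaves B01-S ∧ B01-O.
Theorems only (plus `decide` on a finite Boolean statement).
-/

noncomputable section

open NumberField NumberField.ComplexEmbedding
open Literature.AlgebraicGeometry.Motives (CMType)
open Literature.AlgebraicGeometry.HodgeTheory
open Literature.NumberTheory.Automorphic.PicardCM
open Literature.NumberTheory.ComplexMultiplication (conjGal)
open Literature.NumberTheory.ComplexMultiplication.CMTypeOps
open Literature.NumberTheory.Automorphic.PicardCM.CMCode (cmTypeMap mem_cmTypeMap_iff)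

namespace Summit.HodgeConjecture.CorCM

namespace CyclicSextic

/-! ### §1 The finite check -/

/-- **Combinatorial core** (`decide`): for antipodal indicator vectors `χ₀ = mkType x y z` (base face, places `{0,3}` and `{b₀, b₀+3}`)
and `χ = mkType x' y' z'` (target face, places `{a, a+3} ≠ {a', a'+3}`), some shift `k` makes the twisted base face
(`shiftB k χ₀`; places `{-k, -k+3}`, `{b₀-k, b₀-k+3}`) have the same unordered pair of places as the target and a base vector differing
from `χ` only by flips at those two places. [folklore] -/
theorem twistSquareB :
    ∀ (x y z x' y' z' : Bool) (b₀ a a' : Fin 6), b₀ ≠ 0 → b₀ ≠ 3 → ¬ (a = a' ∨ a + 3 = a') →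
      ∃ k : Fin 6,
        (((a = -k ∨ a + 3 = -k) ∧ (a' = b₀ - k ∨ a' + 3 = b₀ - k)) ∨
          ((a = b₀ - k ∨ a + 3 = b₀ - k) ∧ (a' = -k ∨ a' + 3 = -k))) ∧
        (mkType x' y' z' = shiftB k (mkType x y z) ∨
          mkType x' y' z' = flipB (-k) (shiftB k (mkType x y z)) ∨
          mkType x' y' z' = flipB (b₀ - k) (shiftB k (mkType x y z)) ∨
          mkType x' y' z' = flipB (b₀ - k) (flipB (-k) (shiftB k (mkType x y z)))) := by
  decide

/-! ### §2 Faces of a Galois sextic CM field up to Galois twist and type square -/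

variable {K : Type} [Field K] [NumberField K] [IsCMField K] [IsGalois ℚ K]
variable (σ : K ≃ₐ[ℚ] K) (p : K →+* ℂ)

/-- Places in coordinates: `mk (p ∘ σᵐ) = mk (p ∘ σⁿ) ↔ m = n ∨ m + 3 = n` (`σ³ = ρ`). [folklore] -/
theorem mk_emb_eq_mk_emb_iff (hσ : orderOf σ = 6) (h3 : σ ^ 3 = conjGal) (m n : Fin 6) :
    InfinitePlace.mk (emb σ p m) = InfinitePlace.mk (emb σ p n) ↔ m = n ∨ m + 3 = n := by
  rw [InfinitePlace.mk_eq_iff, emb_fin_eq_iff σ p hσ, conjugate_emb σ p h3,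
    show emb σ p ((m : ℕ) + 3) = emb σ p ((m + 3 : Fin 6) : ℕ) by rw [emb_fin_add σ p hσ]; rfl,
    emb_fin_eq_iff σ p hσ]

omit [IsCMField K] [IsGalois ℚ K] in
/-- `(σᵏ)⁻¹ = σ^{-k}` for `σ` of order `6`, on ring maps. [folklore] -/
theorem pow_symm_toRingHom (hσ : orderOf σ = 6) (k : Fin 6) :
    (σ ^ (k : ℕ)).toRingEquiv.symm.toRingHom = (σ ^ ((-k : Fin 6) : ℕ)).toRingEquiv.toRingHom := by
  have hinv : (σ ^ (k : ℕ))⁻¹ = σ ^ ((-k : Fin 6) : ℕ) := by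
    rw [inv_eq_iff_mul_eq_one, ← pow_add, ← pow_mod_orderOf, hσ]
    have h0 : ((k : ℕ) + ((-k : Fin 6) : ℕ)) % 6 = 0 := by
      have h := Fin.val_add k (-k)
      rw [add_neg_cancel, Fin.val_zero] at h
      omega
    rw [h0, pow_zero]
  ext x
  change (σ ^ (k : ℕ)).symm x = (σ ^ ((-k : Fin 6) : ℕ)) x
  rw [← AlgEquiv.aut_inv, hinv]

/-- **Every face of a Galois sextic CM field has the type square of a Galois twist of any other face.**  For faces `f₀, f` there is
`k` such that `f` and `f₀.twist (σᵏ)` have the same unordered pair of places and the base type of `f` is one of the four corners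
`Φ′, Φ′^{(π)}, Φ′^{(π′)}, Φ′^{(ππ′)}` of the square of `f₀.twist (σᵏ)` (the hypothesis shape of b07's `periodNV_iff_of_sameSquare`). [folklore] -/
theorem exists_twist_sameSquare (h6 : Module.finrank ℚ K = 6) (hσ : orderOf σ = 6) (h3 : σ ^ 3 = conjGal) (f₀ f : Face K) :
    ∃ k : Fin 6,
      ((InfinitePlace.mk f.p = InfinitePlace.mk (f₀.twist (σ ^ (k : ℕ)).toRingEquiv).p ∧
          InfinitePlace.mk f.p' = InfinitePlace.mk (f₀.twist (σ ^ (k : ℕ)).toRingEquiv).p') ∨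
        (InfinitePlace.mk f.p = InfinitePlace.mk (f₀.twist (σ ^ (k : ℕ)).toRingEquiv).p' ∧
          InfinitePlace.mk f.p' = InfinitePlace.mk (f₀.twist (σ ^ (k : ℕ)).toRingEquiv).p)) ∧
      (f.Φ = (f₀.twist (σ ^ (k : ℕ)).toRingEquiv).Φ ∨
        f.Φ = flip (f₀.twist (σ ^ (k : ℕ)).toRingEquiv).p (f₀.twist (σ ^ (k : ℕ)).toRingEquiv).Φ ∨
        f.Φ = flip (f₀.twist (σ ^ (k : ℕ)).toRingEquiv).p' (f₀.twist (σ ^ (k : ℕ)).toRingEquiv).Φ ∨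
        f.Φ = flip (f₀.twist (σ ^ (k : ℕ)).toRingEquiv).p'
          (flip (f₀.twist (σ ^ (k : ℕ)).toRingEquiv).p (f₀.twist (σ ^ (k : ℕ)).toRingEquiv).Φ)) := by
  -- coordinates with base embedding `f₀.p`
  set q := f₀.p with hq
  obtain ⟨b₀, hb₀⟩ := exists_emb_eq σ q h6 hσ f₀.p'
  obtain ⟨a, ha⟩ := exists_emb_eq σ q h6 hσ f.p
  obtain ⟨a', ha'⟩ := exists_emb_eq σ q h6 hσ f.p'
  have hq0 : emb σ q ((0 : Fin 6) : ℕ) = f₀.p := emb_zero σ q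
  have hb00 : b₀ ≠ 0 := by
    rintro rfl
    exact f₀.place_ne (by rw [← hb₀, hq0])
  have hb03 : b₀ ≠ 3 := by
    rintro rfl
    refine f₀.place_ne ?_
    rw [← hq0, ← hb₀, mk_emb_eq_mk_emb_iff σ q hσ h3]
    exact Or.inr rfl
  have haa' : ¬ (a = a' ∨ a + 3 = a') := by
    intro h
    exact f.place_ne (by rw [← ha, ← ha', mk_emb_eq_mk_emb_iff σ q hσ h3]; exact h)
  -- the indicator vectors
  set χ₀ := ind6 σ q f₀.Φ with hχ₀def
  set χ := ind6 σ q f.Φ with hχdef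
  have hχ₀ : χ₀ = mkType (χ₀ 0) (χ₀ 1) (χ₀ 2) := eq_mkType_of_antipodal χ₀ (ind6_antipodal σ q hσ h3 f₀.Φ)
  have hχ : χ = mkType (χ 0) (χ 1) (χ 2) := eq_mkType_of_antipodal χ (ind6_antipodal σ q hσ h3 f.Φ)
  obtain ⟨k, hpl, hΦ⟩ := twistSquareB (χ₀ 0) (χ₀ 1) (χ₀ 2) (χ 0) (χ 1) (χ 2) b₀ a a' hb00 hb03 haa'
  rw [← hχ₀, ← hχ] at hΦ
  -- the twisted face in coordinates
  have htp : (f₀.twist (σ ^ (k : ℕ)).toRingEquiv).p = emb σ q ((-k : Fin 6) : ℕ) := by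
    show f₀.p.comp (σ ^ (k : ℕ)).toRingEquiv.symm.toRingHom = _
    rw [pow_symm_toRingHom σ hσ k]
    rfl
  have htp' : (f₀.twist (σ ^ (k : ℕ)).toRingEquiv).p' = emb σ q ((b₀ - k : Fin 6) : ℕ) := by
    show f₀.p'.comp (σ ^ (k : ℕ)).toRingEquiv.symm.toRingHom = _
    rw [← hb₀, pow_symm_toRingHom σ hσ k, emb_comp_pow, sub_eq_add_neg, emb_fin_add σ q hσ]
  have htΦ : ind6 σ q (f₀.twist (σ ^ (k : ℕ)).toRingEquiv).Φ = shiftB k χ₀ := ind6_cmTypeMap σ q hσ f₀.Φ k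
  have hiff : ∀ Φ Φ' : CMType K, ind6 σ q Φ = ind6 σ q Φ' ↔ Φ = Φ' := ind6_eq_iff σ q h6 hσ
  refine ⟨k, ?_, ?_⟩
  · rw [← ha, ← ha', htp, htp', mk_emb_eq_mk_emb_iff σ q hσ h3, mk_emb_eq_mk_emb_iff σ q hσ h3,
      mk_emb_eq_mk_emb_iff σ q hσ h3, mk_emb_eq_mk_emb_iff σ q hσ h3]
    exact hpl
  · rw [← hiff, ← hiff, ← hiff, ← hiff, htp, htp', ind6_flip σ q hσ h3, ind6_flip σ q hσ h3, ind6_flip σ q hσ h3,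
      ind6_flip σ q hσ h3, htΦ]
    exact hΦ

end CyclicSextic

/-! ### §3 On the universe of record -/

namespace Model

open CyclicSextic

variable (hHD : exists_isReal_hodgeModel) (hI : hodgePQ_independent_of_hodgeModel)
  (h₁ : BallQuotientUniformised) (h₃ : CMAbelianVarietyRealised)

/-- **Over a Galois sextic CM field, ONE non-zero face period gives them all** (universe of record).  If `U.PeriodNV ι₀ V₀ F f₀.psi ι₀`
for one face `f₀`, one admissible `ι₀` and one hermitian space `V₀`, then `U.PeriodNV ι₁ V F f.psi ι₁` for every face `f`, every
admissible `ι₁` and every `V`: `ι₁ = ι₀ ∘ σᵐ` (Galois), `f ~_square f₀.twist (σᵏ)` (`exists_twist_sameSquare`), the orbit normal form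
`Model.periodNV_orbit` (rows A/B/C/T) and b07's `Model.periodNV_iff_of_sameSquare`. [folklore] -/
theorem periodNV_of_periodNV_sextic {F : CMField} [IsGalois ℚ F] (h6 : Module.finrank ℚ F = 6)
    {f₀ : Face F} {ι₀ : F →+* ℂ} (hι₀ : f₀.Admissible ι₀) {V₀ : HermSpace3 F ι₀}
    (h : (picardCMUniverse hHD hI h₁ h₃).PeriodNV ι₀ V₀ F f₀.psi ι₀)
    (f : Face F) (ι₁ : F →+* ℂ) (hι : f.Admissible ι₁) (V : HermSpace3 F ι₁) :
    (picardCMUniverse hHD hI h₁ h₃).PeriodNV ι₁ V F f.psi ι₁ := by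
  have hF : 2 < Module.finrank ℚ F := by omega
  obtain ⟨σ, hσ, h3⟩ := exists_generator (K := F) h6
  obtain ⟨k, hpl, hΦ⟩ := exists_twist_sameSquare σ h6 hσ h3 f₀ f
  obtain ⟨m, hm⟩ := exists_emb_eq σ ι₀ h6 hσ ι₁
  subst hm
  -- `ι₁ = ι₀ ∘ σᵐ = ι₀ ∘ h'⁻¹` with `h' = (σᵐ)⁻¹`
  have hτ : (f₀.twist (σ ^ (k : ℕ)).toRingEquiv).Admissible (emb σ ι₀ m) :=
    (Face.admissible_iff_of_sameSquare hpl hΦ _).1 hι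
  have key := periodNV_orbit hHD hI h₁ h₃ hF f₀ hι₀ h (σ ^ (k : ℕ)).toRingEquiv (σ ^ (m : ℕ)).toRingEquiv.symm
    (emb σ ι₀ m) hτ V
  exact (periodNV_iff_of_sameSquare hHD hI h₁ h₃ hpl hΦ V (emb σ ι₀ m)).2 key

/-- **The degree-6 part of the face period theorem on the universe of record ⇔ one instance per field.** [folklore] -/
theorem periodThmF_sextic_iff_exists :
    (∀ (F : CMField), IsGalois ℚ F → Module.finrank ℚ F = 6 →
        ∀ (f : Face F) (ι₁ : F →+* ℂ), f.Admissible ι₁ → ∀ V : HermSpace3 F ι₁,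
          (picardCMUniverse hHD hI h₁ h₃).PeriodNV ι₁ V F f.psi ι₁) ↔
      ∀ (F : CMField), IsGalois ℚ F → Module.finrank ℚ F = 6 →
        ∃ (f₀ : Face F) (ι₀ : F →+* ℂ) (V₀ : HermSpace3 F ι₀), f₀.Admissible ι₀ ∧
          (picardCMUniverse hHD hI h₁ h₃).PeriodNV ι₀ V₀ F f₀.psi ι₀ := by
  constructor
  · intro hall F hG h6
    haveI := hG
    -- a face, an admissible embedding and a hermitian space exist at degree 6
    obtain ⟨f₀, ι₀, hι₀⟩ := exists_face_admissible F (by omega)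
    obtain ⟨V₀⟩ := landherr_exists_proof F ι₀
    exact ⟨f₀, ι₀, V₀, hι₀, hall F hG h6 f₀ ι₀ hι₀ V₀⟩
  · intro hex F hG h6 f ι₁ hι V
    haveI := hG
    obtain ⟨f₀, ι₀, V₀, hι₀, h0⟩ := hex F hG h6
    exact periodNV_of_periodNV_sextic hHD hI h₁ h₃ h6 hι₀ h0 f ι₁ hι V

end Model

end Summit.HodgeConjecture.CorCM

end
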